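import Literature.AlgebraicGeometry.Frobenioids.QuasiTemperoidPushforwardSquare
import Literature.AnabelianGeometry.SemiGraphs.BTempResEquiv
import HarnessLib

/-!
# [FrdII] Ex 1.3 (ii) / Thm 2.4 (i): `Aut_E(A_E) ⥲ Aut_{E′}(A′_{E′})` along a commuting square of open surjections

abc-iut-w6-d047, T44-L15b E-part §2: the field `isoE` of the [FrdII] Def 2.2 context isomorphism, as an EXISTENCE
theorem (proof-only; the isomorphism is determined on `φ_*(Aut A)`, which is all of `Aut(φ_* A)` for Galois `A` by
abc-iut-w6-d047's `exists_pushforwardOuterRep`).  For the square `ι ∘ φ = φ′ ∘ θ` (`θ : Π₁ ⥲ Π₁′`, `ι : Π₂ ⥲ Π₂′`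
isomorphisms of topological groups, `φ`, `φ′` open surjections), an isomorphism `J : φ_* ⋙ B^temp(ι⁻¹) ≅ B^temp(θ⁻¹) ⋙ φ′_*` which is the identity on representatives
(abc-iut-w6-d047's `exists_orbitsSquareIso`), a connected `A` over `Π₁`, a connected `B` over `Π₁′` and
`β : B ≅ B^temp(θ⁻¹)(A)`, there is `Aut_{B^temp(Π₂)⁰}(φ_* A) ⥲ Aut_{B^temp(Π₂′)⁰}(φ′_* B)` whose value on `φ_*(σ)`,
`σ ∈ Aut(A)`, is `φ′_*(β⁻¹ ∘ B^temp(θ⁻¹)(σ) ∘ β)` ([FrdII] Thm 2.4 (i): «`Ψ` induces … `Aut_{E₁}((A₁)_{E₁}) ⥲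
Aut_{E₂}((A₂)_{E₂})`»; [SemiAnbd] Rmk 3.1.2 for `B^temp(ι⁻¹)`).

References: [MochizukiFrdII2008] S. Mochizuki, *The geometry of Frobenioids II*, Kyushu J. Math. 62 (2008), Ex 1.3 (ii)
p.11, Thm 2.4 (i) p.19; [MochizukiSemiAnbd2006] S. Mochizuki, *Semi-graphs of anabelioids*, Publ. RIMS 42 (2006),
Rmk 3.1.2 pp.33–34.
-/

namespace Literature.AlgebraicGeometry.Frobenioids

namespace QuasiTemperoid

open CategoryTheory Literature.AnabelianGeometry.SemiGraphs BTempConnected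

universe u

variable {G₁ : Type u} [Group G₁] [TopologicalSpace G₁] [IsTopologicalGroup G₁]
  {G₂ : Type u} [Group G₂] [TopologicalSpace G₂]
  {G₁' : Type u} [Group G₁'] [TopologicalSpace G₁'] [IsTopologicalGroup G₁']
  {G₂' : Type u} [Group G₂'] [TopologicalSpace G₂']
  (φ : G₁ →* G₂) (hs : Function.Surjective φ) (hφ : IsOpenMap φ)
  (φ' : G₁' →* G₂') (hs' : Function.Surjective φ') (hφ' : IsOpenMap φ')
  (θ : G₁ ≃ₜ* G₁') (ι : G₂ ≃ₜ* G₂')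

/-- `J⁻¹` is the identity on representatives when `J` is. [cite: MochizukiFrdII2008, Ex 1.3 (ii) p.11] -/
theorem squareIso_inv_app_mk
    (J : orbits φ hs hφ ⋙ BTemp.res (ι.symm : G₂' →ₜ* G₂) ≅ BTemp.res (θ.symm : G₁' →ₜ* G₁) ⋙ orbits φ' hs' hφ')
    (hJ : ∀ (X : BTemp G₁) (x : X.obj.V),
      ((J.hom.app X).hom.hom (orbitMk x : OrbitSet φ X) : OrbitSet φ' ((BTemp.res (θ.symm : G₁' →ₜ* G₁)).obj X)) =
        orbitMk (X := (BTemp.res (θ.symm : G₁' →ₜ* G₁)).obj X) x)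
    (X : BTemp G₁) (x : X.obj.V) :
    ((J.inv.app X).hom.hom (orbitMk (X := (BTemp.res (θ.symm : G₁' →ₜ* G₁)).obj X) x) : OrbitSet φ X) =
      orbitMk x := by
  have h := congrArg (fun q => (J.inv.app X).hom.hom q) (hJ X x)
  have h2 : ((J.hom.app X ≫ J.inv.app X).hom.hom (orbitMk x : OrbitSet φ X) : OrbitSet φ X) = orbitMk x := by
    rw [Iso.hom_inv_id_app]; rfl
  exact h.symm.trans h2

/-- **`Aut_{B^temp(Π₂)⁰}(φ_* A) ⥲ Aut_{B^temp(Π₂′)⁰}(φ′_* B)` along the square, EXISTENCE with its value on `φ_*(σ)`**: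
for `J : φ_* ⋙ B^temp(ι⁻¹) ≅ B^temp(θ⁻¹) ⋙ φ′_*` the identity on representatives (`hJ`, abc-iut-w6-d047's
`exists_orbitsSquareIso`) and `β : B ≅ B^temp(θ⁻¹)(A)`, there is a group isomorphism `E` with
`E(φ_*(σ)) = φ′_*(β⁻¹ ∘ B^temp(θ⁻¹)(σ) ∘ β)` for all `σ ∈ Aut(A)` — transport to `B^temp(Π₂)` (full subcategory), the
equivalence `B^temp(ι⁻¹)` ([SemiAnbd] Rmk 3.1.2), conjugation by `J_A ≫ φ′_*(β⁻¹)`, transport back; the value is checked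
on classes of points `[b]`, `b ∈ B`. [cite: MochizukiFrdII2008, Thm 2.4 (i) p.19] -/
theorem exists_squareAutEquiv
    (J : orbits φ hs hφ ⋙ BTemp.res (ι.symm : G₂' →ₜ* G₂) ≅ BTemp.res (θ.symm : G₁' →ₜ* G₁) ⋙ orbits φ' hs' hφ')
    (hJ : ∀ (X : BTemp G₁) (x : X.obj.V),
      ((J.hom.app X).hom.hom (orbitMk x : OrbitSet φ X) : OrbitSet φ' ((BTemp.res (θ.symm : G₁' →ₜ* G₁)).obj X)) =
        orbitMk (X := (BTemp.res (θ.symm : G₁' →ₜ* G₁)).obj X) x)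
    (A : ConnectedPart (BTemp G₁)) (B : ConnectedPart (BTemp G₁'))
    (β : B.obj ≅ (BTemp.res (θ.symm : G₁' →ₜ* G₁)).obj A.obj) :
    ∃ E : Aut ((pushforward φ hs hφ).obj A) ≃* Aut ((pushforward φ' hs' hφ').obj B), ∀ σ : Aut A,
      E ((pushforward φ hs hφ).mapAut A σ) =
        (pushforward φ' hs' hφ').mapAut B
          (((connectedObjects (BTemp G₁')).fullyFaithfulι.autMulEquivOfFullyFaithful B).symm
            (β.symm.conjAut ((BTemp.res (θ.symm : G₁' →ₜ* G₁)).mapAut A.obj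
              ((connectedObjects (BTemp G₁)).fullyFaithfulι.autMulEquivOfFullyFaithful A σ)))) := by
  refine ⟨(((connectedObjects (BTemp G₂)).fullyFaithfulι.autMulEquivOfFullyFaithful ((pushforward φ hs hφ).obj A)).trans
    (((BTemp.resEquiv ι.symm).fullyFaithfulFunctor.autMulEquivOfFullyFaithful (orbitObj φ hs hφ A.obj)).trans
      (Iso.conjAut (J.app A.obj ≪≫ (orbits φ' hs' hφ').mapIso β.symm)))).trans
    ((connectedObjects (BTemp G₂')).fullyFaithfulι.autMulEquivOfFullyFaithful ((pushforward φ' hs' hφ').obj B)).symm,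
    fun σ => ?_⟩
  apply Iso.ext
  apply ObjectProperty.hom_ext
  apply BTempConnected.hom_ext_apply
  intro q
  obtain ⟨b, rfl⟩ := orbitMk_surjective (φ := φ') B.obj q
  -- both sides evaluated on the class `[b]`; everything but the two components of `J` computes definitionally
  change ((orbits φ' hs' hφ').map β.inv).hom.hom ((J.hom.app A.obj).hom.hom
      (((BTemp.res (ι.symm : G₂' →ₜ* G₂)).map ((orbits φ hs hφ).map σ.hom.hom)).hom.hom
        ((J.inv.app A.obj).hom.hom (orbitMk (X := (BTemp.res (θ.symm : G₁' →ₜ* G₁)).obj A.obj)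
          (β.hom.hom.hom b))))) =
    (orbitMk (X := B.obj) (β.inv.hom.hom (σ.hom.hom.hom.hom (β.hom.hom.hom b))) : OrbitSet φ' B.obj)
  rw [squareIso_inv_app_mk φ hs hφ φ' hs' hφ' θ ι J hJ]
  change ((orbits φ' hs' hφ').map β.inv).hom.hom ((J.hom.app A.obj).hom.hom
      (orbitMk (σ.hom.hom.hom.hom (β.hom.hom.hom b)) : OrbitSet φ A.obj)) = _
  rw [hJ]
  rfl

end QuasiTemperoid

end Literature.AlgebraicGeometry.Frobenioids
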